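import Summits.Parity.BatemanHorn.Theorems.AlmostPrimeZerosSystemLSDRealSegmentNairUpperBound
import Summits.Parity.BatemanHorn.Theorems.AlmostPrimeZerosSystemLSDRealSegmentSmoothTailRankin
import Summits.Parity.BatemanHorn.Theorems.AlmostPrimeZerosSystemLSDRealSegmentTwistedDomination
import Summits.Parity.BatemanHorn.Theorems.AlmostPrimeZerosSystemLSDRealSegmentTwistedMertens
import HarnessLib

/-!
# `SystemLSDRealSegment` (stmt-Parity-11292), line `beta-thinned-root-kernel`: the SMOOTH part of the kernel is
# negligible (lead c9 — the registered stub `stub_smoothKernel_negligible` of skeleton rev L5)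

The open content of the crux is the kernel law `BetaKernelLaw k f y` (beyond-level-`x` divisor tuples of the values of
a Bateman–Horn system, weights `∏ h_y(dᵢ) ≥ 0`).  This file proves that the part of the kernel carried by `S`-SMOOTH
tuples (`∏ dᵢ ∈ Nat.smoothNumbers S`: all prime factors `< S`) is negligible:

* `smoothKernel_le` (height form) — for every Bateman–Horn system `f` and real `y ≥ 1` there are `C > 0`, `x₀` with
  `Σ_{n≤x} Σ_{d : ∏dᵢ > x, ∏dᵢ S-smooth} ∏h_y(dᵢ) ≤ C · x · e^{−2 log x/log S} · (log S)^{k(y−1)}` for all `x ≥ x₀`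
  and ALL `S ≥ 2`;
* `smoothKernel_negligible` / `stub_smoothKernel_negligible` (`θ`-form, `S = ⌊x^θ⌋₊ + 1`) — `≤ C e^{−1/θ} x (log x)^{k(y−1)}`
  for every `θ ∈ (0, 1]` and all large `x`, the shape consumed by the glue `betaKernelLaw_of_roughLaw`
  (`…RoughKernelReduction.lean`): so `BetaKernelLaw k f y` is EQUIVALENT to the law of the ROUGH part of the kernel.

Proof: Rankin's trick in each row (`stub_smoothTail_rankin`, exponent `δ = 2/log S`), domination of the product of the
twisted smooth divisor sums by ONE multiplicative weight `G̃` of the value of the product polynomial, exact at simple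
prime factors (`stub_twistedDivisorSum_domination`), Nair–Tenenbaum light (`nairTenenbaumLight`, lead c8) for the
shifted product polynomial with the weight class `G̃(p^v) ≤ (y²e⁴)^(k+1)` (independent of `S`), and the twisted Mertens
exponent `Σ_{p ≤ x}(G̃(p) − 1)ρ_f(p)/p ≤ (y−1)k log log S + B` (`stub_twistedMertens_exponent`); the rows `n ≤ n₀` carry no
beyond-level tuple once `x` exceeds their values.  Everything is PROVED; no definitions.
-/

open Filter Finset Polynomial
open scoped BigOperators Topology

namespace Summit.Parity.BatemanHorn.Cruxes.SystemLSDRealSegment.BetaThinnedRootKernel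

open Literature.NumberTheory.Sieve
open Summit.Parity.BatemanHorn.Cruxes.SystemLSDRealSegment.BetaThinnedRootKernel.Nair

noncomputable section

/-! ### Small rows carry no beyond-level tuples -/

section Assembly

variable {k : ℕ} {f : Fin k → ℤ[X]}

/-- Every divisor tuple of row `n` has level `∏ dᵢ ≤ ∏ᵢ max (fᵢ(n)).toNat 1`. [folklore] -/
theorem prod_le_of_mem_tuples (f : Fin k → ℤ[X]) {n : ℕ} {d : Fin k → ℕ} (hd : d ∈ tuples f n) :
    ∏ i, d i ≤ ∏ i, max ((f i).eval (n : ℤ)).toNat 1 := by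
  refine Finset.prod_le_prod' fun i _ => ?_
  have h : d i ∈ divSet ((f i).eval (n : ℤ)).toNat := Fintype.mem_piFinset.mp hd i
  exact Nat.divisor_le h

/-- For `x ≥ Σ_{n ≤ n₀} ∏ᵢ max (fᵢ(n)).toNat 1` the rows `n ≤ n₀` have NO tuple of level `> x` (any extra
condition `P`). [folklore] -/
theorem sum_small_rows_eq_zero (f : Fin k → ℤ[X]) (y : ℝ) (P : (Fin k → ℕ) → Prop) [DecidablePred P]
    {n₀ x : ℕ} (hx : ∑ n ∈ range (n₀ + 1), ∏ i, max ((f i).eval (n : ℤ)).toNat 1 ≤ x) :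
    ∑ n ∈ range (n₀ + 1), ∑ d ∈ (tuples f n).filter (fun d => x < ∏ i, d i ∧ P d),
      ∏ i, thinWeight y (d i) = 0 := by
  refine Finset.sum_eq_zero fun n hn => ?_
  have hle : ∏ i, max ((f i).eval (n : ℤ)).toNat 1 ≤ x :=
    le_trans (Finset.single_le_sum (s := range (n₀ + 1))
      (f := fun m : ℕ => ∏ i, max ((f i).eval (m : ℤ)).toNat 1) (fun m _ => Nat.zero_le _) hn) hx
  refine Finset.sum_eq_zero fun d hd => ?_
  rw [Finset.mem_filter] at hd
  exact absurd (lt_of_lt_of_le hd.2.1 ((prod_le_of_mem_tuples f hd.1).trans hle)) (lt_irrefl _)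

/-- The weight of a prime is its `v = 1` factor: `p.factorization.prod g = g p 1`. [folklore] -/
theorem factorization_prod_prime {p : ℕ} (hp : p.Prime) (g : ℕ → ℕ → ℝ) :
    p.factorization.prod g = g p 1 := by
  rw [hp.factorization, Finsupp.prod, Finsupp.support_single _ one_ne_zero, Finset.prod_singleton,
    Finsupp.single_eq_same]

/-- **The smooth part of the kernel, height form**: for a Bateman–Horn system `f` and real `y ≥ 1` there are `C > 0`
and `x₀` with
`Σ_{n≤x} Σ_{d : ∏dᵢ > x, ∏dᵢ S-smooth} ∏h_y(dᵢ) ≤ C · x · exp(−2 log x / log S) · (log S)^{k(y−1)}`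
for all `x ≥ x₀` and all `S ≥ 2` (Rankin with `δ = 2/log S`, Nair–Tenenbaum light for the twisted weight). [folklore] -/
theorem smoothKernel_le (hf : IsBatemanHornSystem f) {y : ℝ} (hy : 1 ≤ y) :
    ∃ C : ℝ, 0 < C ∧ ∃ x₀ : ℕ, ∀ x : ℕ, x₀ ≤ x → ∀ S : ℕ, 2 ≤ S →
      (∑ n ∈ range (x + 1), ∑ d ∈ (tuples f n).filter
          (fun d => x < ∏ i, d i ∧ (∏ i, d i) ∈ Nat.smoothNumbers S), ∏ i, thinWeight y (d i)) ≤
        C * ((x : ℝ) * Real.exp (-(2 * Real.log x) / Real.log S) * Real.log S ^ ((k : ℝ) * (y - 1))) := by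
  have hy0 : 0 ≤ y := by linarith
  obtain ⟨n₀, hn₀⟩ := exists_forall_two_le_eval' hf
  -- threshold for the small rows
  set X₀ : ℕ := ∑ n ∈ range (n₀ + 1), ∏ i, max ((f i).eval (n : ℤ)).toNat 1 with hX₀
  rcases Nat.eq_zero_or_pos k with hk0 | hk
  · -- `k = 0`: the only tuple is the empty one, of level `1 ≤ x`
    subst hk0
    refine ⟨1, one_pos, X₀ + 1, fun x hx S hS => ?_⟩
    have hsmall := sum_small_rows_eq_zero f y (fun d : Fin 0 → ℕ => (∏ i, d i) ∈ Nat.smoothNumbers S)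
      (n₀ := n₀) (x := x) (by omega)
    -- all rows are "small": for `k = 0` every row has the same (empty) tuple set, level `1`
    have hall : ∑ n ∈ range (x + 1), ∑ d ∈ (tuples f n).filter
        (fun d => x < ∏ i, d i ∧ (∏ i, d i) ∈ Nat.smoothNumbers S), ∏ i, thinWeight y (d i) = 0 := by
      refine Finset.sum_eq_zero fun n _ => Finset.sum_eq_zero fun d hd => ?_
      rw [Finset.mem_filter] at hd
      have : ∏ i, d i = 1 := Finset.prod_of_isEmpty _
      omega
    rw [hall]
    have hS1 : (1 : ℝ) < S := by exact_mod_cast hS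
    have hlogS : 0 < Real.log S := Real.log_pos hS1
    positivity
  -- `k ≥ 1`: the product polynomial, shifted to be positive on `ℕ_{≥ 1}`
  set F : ℤ[X] := ∏ i, f i with hF
  set Fs : ℤ[X] := F.comp (X + C (n₀ : ℤ)) with hFs
  have hdegF : F.natDegree = ∑ i, (f i).natDegree := natDegree_prod_eq hf
  set D : ℕ := ∑ i, (f i).natDegree with hDdef
  have hD1 : 1 ≤ D := by
    rw [hDdef]
    obtain ⟨i⟩ : Nonempty (Fin k) := ⟨⟨0, hk⟩⟩
    exact Finset.sum_pos' (fun j _ => Nat.zero_le _) ⟨i, mem_univ _, hf.natDegree_pos i⟩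
  have hdFs : 1 ≤ Fs.natDegree := by rw [hFs, natDegree_comp_X_add, hdegF]; exact hD1
  have hposF : ∀ m : ℕ, n₀ ≤ m → 0 < F.eval (m : ℤ) := by
    intro m hm
    rw [hF, eval_prod]
    exact Finset.prod_pos fun i _ => by linarith [hn₀ m hm i]
  have hposFs : ∀ n : ℕ, 1 ≤ n → 0 < Fs.eval (n : ℤ) := by
    intro n _
    rw [hFs, eval_comp_X_add]
    exact hposF _ (by omega)
  have hDρ : ∀ p : ℕ, p.Prime → polyRootCountMod ![Fs] p ≤ D := fun p hp => by
    rw [hFs, polyRootCountMod_comp_X_add]; exact rootCount_prod_le_totalDegree hf hp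
  have hfixρ : ∀ p : ℕ, p.Prime → polyRootCountMod ![Fs] p < p := fun p hp => by
    rw [hFs, polyRootCountMod_comp_X_add]; exact rootCount_prod_lt hf hp
  obtain ⟨M₀, hM₀, hMF⟩ := exists_rootCount_prod_prime_pow_le hf hk
  have hMρ : ∀ p : ℕ, p.Prime → ∀ a : ℕ, 1 ≤ a → polyRootCountMod ![Fs] (p ^ a) ≤ F.natDegree * M₀ :=
    fun p hp a _ => by rw [hFs, polyRootCountMod_comp_X_add]; exact hMF p hp a
  have hM1 : 1 ≤ F.natDegree * M₀ := Nat.one_le_iff_ne_zero.2 (Nat.mul_ne_zero (by rw [hdegF]; omega) (by omega))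
  -- the weight class `G(p^v) ≤ A`, `A = (y² e⁴)^(k+1)`, independent of `S`
  set A : ℝ := (y ^ 2 * Real.exp 4) ^ (k + 1) with hAdef
  have hA : (1 : ℝ) ≤ A := one_le_pow₀ (by nlinarith [Real.add_one_le_exp (4 : ℝ), one_le_pow₀ (M₀ := ℝ) hy (n := 2)])
  obtain ⟨Cn, hCn, hNair⟩ := nairTenenbaumLight Fs D (F.natDegree * M₀) A hdFs hposFs hDρ hD1 hfixρ hMρ hM1 hA
  -- the twisted Mertens exponent
  obtain ⟨B, hB⟩ := stub_twistedMertens_exponent k f hf y hy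
  refine ⟨Cn * Real.exp B, by positivity, max X₀ (n₀ + 2), fun x hx S hS => ?_⟩
  have hxX₀ : X₀ ≤ x := le_of_max_le_left hx
  have hxn₀ : n₀ + 2 ≤ x := le_of_max_le_right hx
  have hx1 : 1 ≤ x := by omega
  have hx0 : (0 : ℝ) < x := by exact_mod_cast (show 0 < x by omega)
  have hS1 : (1 : ℝ) < S := by exact_mod_cast hS
  have hS0 : (0 : ℝ) < S := by linarith
  have hlogS : 0 < Real.log S := Real.log_pos hS1
  set δ : ℝ := 2 / Real.log S with hδ
  have hδ0 : 0 ≤ δ := by positivity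
  -- the weight
  set G : ℕ → ℝ := fun M => M.factorization.prod fun p v =>
      if v = 1 then (if p < S then 1 + (y - 1) * (p : ℝ) ^ (2 / Real.log S) else 1)
      else (y ^ 2 * (S : ℝ) ^ (2 * (2 / Real.log S))) ^ k with hGdef
  obtain ⟨hG0, hG1, hGmul, hGA⟩ := stub_twistedDivisorSum_domination.2 k y hy S hS
  have hDom := stub_twistedDivisorSum_domination.1 k y hy δ hδ0 S (by omega)
  -- (1) split the rows at `n₀ + 1`; the small rows vanish
  have hsplit : ∑ n ∈ range (x + 1), ∑ d ∈ (tuples f n).filter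
        (fun d => x < ∏ i, d i ∧ (∏ i, d i) ∈ Nat.smoothNumbers S), ∏ i, thinWeight y (d i) =
      ∑ n ∈ Ico (n₀ + 1) (x + 1), ∑ d ∈ (tuples f n).filter
        (fun d => x < ∏ i, d i ∧ (∏ i, d i) ∈ Nat.smoothNumbers S), ∏ i, thinWeight y (d i) := by
    have h0 := sum_small_rows_eq_zero f y (fun d : Fin k → ℕ => (∏ i, d i) ∈ Nat.smoothNumbers S)
      (n₀ := n₀) (x := x) hxX₀
    rw [Finset.range_eq_Ico, ← Finset.sum_Ico_consecutive _ (Nat.zero_le (n₀ + 1)) (by omega : n₀ + 1 ≤ x + 1),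
      ← Finset.range_eq_Ico, h0, zero_add]
  -- (2) each big row: Rankin, then domination by `G(Fs(n - n₀))`
  have hrow : ∀ n ∈ Ico (n₀ + 1) (x + 1),
      ∑ d ∈ (tuples f n).filter (fun d => x < ∏ i, d i ∧ (∏ i, d i) ∈ Nat.smoothNumbers S),
          ∏ i, thinWeight y (d i) ≤
        (x : ℝ) ^ (-δ) * G ((Fs.eval ((n - n₀ : ℕ) : ℤ)).toNat) := by
    intro n hn
    rw [Finset.mem_Ico] at hn
    have hn1 : ∀ i, (1 : ℤ) ≤ (f i).eval (n : ℤ) := fun i => by linarith [hn₀ n (by omega) i]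
    have hne : ∀ i, ((f i).eval (n : ℤ)).toNat ≠ 0 := fun i => by
      have := hn1 i
      omega
    refine (stub_smoothTail_rankin k f y hy δ hδ0 S x n hx1).trans ?_
    refine mul_le_mul_of_nonneg_left ?_ (Real.rpow_nonneg hx0.le _)
    refine (hDom (fun i => ((f i).eval (n : ℤ)).toNat) hne).trans (le_of_eq ?_)
    rw [← toNat_eval_prod fun i => by linarith [hn1 i], hFs, eval_comp_X_add, ← hF,
      show n - n₀ + n₀ = n from by omega]
  -- (3) sum of the big rows against Nair's sum
  have hbig : ∑ n ∈ Ico (n₀ + 1) (x + 1), (x : ℝ) ^ (-δ) * G ((Fs.eval ((n - n₀ : ℕ) : ℤ)).toNat) ≤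
      (x : ℝ) ^ (-δ) * ∑ m ∈ Icc 1 x, G ((Fs.eval (m : ℤ)).toNat) := by
    rw [← Finset.mul_sum]
    refine mul_le_mul_of_nonneg_left ?_ (Real.rpow_nonneg hx0.le _)
    rw [Finset.sum_Ico_eq_sum_range]
    calc ∑ j ∈ range (x + 1 - (n₀ + 1)), G ((Fs.eval ((n₀ + 1 + j - n₀ : ℕ) : ℤ)).toNat)
        = ∑ j ∈ range (x - n₀), G ((Fs.eval ((1 + j : ℕ) : ℤ)).toNat) := by
          rw [show x + 1 - (n₀ + 1) = x - n₀ from by omega]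
          refine Finset.sum_congr rfl fun j _ => ?_
          rw [show n₀ + 1 + j - n₀ = 1 + j from by omega]
      _ = ∑ m ∈ Ico 1 (x - n₀ + 1), G ((Fs.eval (m : ℤ)).toNat) := by
          rw [Finset.sum_Ico_eq_sum_range, show x - n₀ + 1 - 1 = x - n₀ from by omega]
      _ ≤ ∑ m ∈ Icc 1 x, G ((Fs.eval (m : ℤ)).toNat) := by
          rw [← Finset.Ico_add_one_right_eq_Icc]
          exact Finset.sum_le_sum_of_subset_of_nonneg (Finset.Ico_subset_Ico_right (by omega))
            fun m _ _ => hG0 _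
  -- (4) Nair + the twisted Mertens exponent
  have hN := hNair G hG0 hG1 hGmul hGA x (by omega)
  have hexp : ∑ p ∈ Nat.primesLE x, (G p - 1) * (polyRootCountMod ![Fs] p : ℝ) / p ≤
      (y - 1) * k * Real.log (Real.log S) + B := by
    have h2 : ∑ p ∈ Nat.primesLE x, (G p - 1) * (polyRootCountMod ![Fs] p : ℝ) / p =
        ∑ p ∈ Nat.primesLE x, ((if p < S then 1 + (y - 1) * (p : ℝ) ^ (2 / Real.log S) else 1) - 1) *
          (polyRootCountMod f p : ℝ) / p := by
      refine Finset.sum_congr rfl fun p hp => ?_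
      have hpp := (Nat.mem_primesLE.1 hp).2
      have hGp : G p = (if p < S then 1 + (y - 1) * (p : ℝ) ^ (2 / Real.log S) else 1) := by
        simp only [hGdef]
        rw [factorization_prod_prime hpp, if_pos rfl]
      rw [hGp, hFs, polyRootCountMod_comp_X_add, hF, ← PolyPrimeCountBrun.polyRootCountMod_eq_single_prod]
    rw [h2]
    exact hB S hS x
  have hmain : ∑ m ∈ Icc 1 x, G ((Fs.eval (m : ℤ)).toNat) ≤
      Cn * x * (Real.exp B * Real.log S ^ ((k : ℝ) * (y - 1))) := by
    refine hN.trans ?_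
    have h4 : Real.exp ((y - 1) * k * Real.log (Real.log S) + B) = Real.exp B * Real.log S ^ ((k : ℝ) * (y - 1)) := by
      rw [Real.rpow_def_of_pos hlogS, ← Real.exp_add]; ring_nf
    rw [← h4]
    gcongr
  -- (5) `x^{-δ} = exp(−2 log x / log S)`
  have hxδ : (x : ℝ) ^ (-δ) = Real.exp (-(2 * Real.log x) / Real.log S) := by
    rw [Real.rpow_def_of_pos hx0, hδ]; ring_nf
  -- assemble
  calc ∑ n ∈ range (x + 1), ∑ d ∈ (tuples f n).filter
          (fun d => x < ∏ i, d i ∧ (∏ i, d i) ∈ Nat.smoothNumbers S), ∏ i, thinWeight y (d i)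
      = ∑ n ∈ Ico (n₀ + 1) (x + 1), ∑ d ∈ (tuples f n).filter
          (fun d => x < ∏ i, d i ∧ (∏ i, d i) ∈ Nat.smoothNumbers S), ∏ i, thinWeight y (d i) := hsplit
    _ ≤ ∑ n ∈ Ico (n₀ + 1) (x + 1), (x : ℝ) ^ (-δ) * G ((Fs.eval ((n - n₀ : ℕ) : ℤ)).toNat) :=
        Finset.sum_le_sum hrow
    _ ≤ (x : ℝ) ^ (-δ) * ∑ m ∈ Icc 1 x, G ((Fs.eval (m : ℤ)).toNat) := hbig
    _ ≤ (x : ℝ) ^ (-δ) * (Cn * x * (Real.exp B * Real.log S ^ ((k : ℝ) * (y - 1)))) :=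
        mul_le_mul_of_nonneg_left hmain (Real.rpow_nonneg hx0.le _)
    _ = Cn * Real.exp B * ((x : ℝ) * Real.exp (-(2 * Real.log x) / Real.log S) *
          Real.log S ^ ((k : ℝ) * (y - 1))) := by rw [hxδ]; ring

/-! ### The `θ`-form: height `⌊x^θ⌋₊ + 1` -/

/-- `Nat.smoothNumbers 2 = {1}`: no prime is `< 2`. [folklore] -/
theorem smoothNumbers_two : Nat.smoothNumbers 2 = {1} := by
  rw [Nat.smoothNumbers_succ Nat.not_prime_one, Nat.smoothNumbers_succ Nat.not_prime_zero, Nat.smoothNumbers_zero]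

/-- **The smooth part of the kernel is negligible** (`θ`-form): for a Bateman–Horn system `f` and real `y ≥ 1` there
is `C > 0` such that for every `θ ∈ (0, 1]` and all large `x`,
`Σ_{n≤x} Σ_{d : ∏dᵢ > x, ∏dᵢ (⌊x^θ⌋₊+1)-smooth} ∏h_y(dᵢ) ≤ C e^{−1/θ} · x (log x)^{k(y−1)}`
(from `smoothKernel_le`: for `x^θ ≥ 2`, `log(⌊x^θ⌋₊+1) ≤ 2θ log x`; for `x^θ < 2` the sum is empty). [folklore] -/
theorem smoothKernel_negligible (hf : IsBatemanHornSystem f) {y : ℝ} (hy : 1 ≤ y) :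
    ∃ C : ℝ, 0 < C ∧ ∀ θ : ℝ, 0 < θ → θ ≤ 1 → ∀ᶠ x : ℕ in atTop,
      (∑ n ∈ range (x + 1), ∑ d ∈ (tuples f n).filter
          (fun d => x < ∏ i, d i ∧ (∏ i, d i) ∈ Nat.smoothNumbers (⌊(x : ℝ) ^ θ⌋₊ + 1)),
            ∏ i, thinWeight y (d i)) ≤
        C * Real.exp (-1 / θ) * ((x : ℝ) * Real.log x ^ ((k : ℝ) * (y - 1))) := by
  obtain ⟨C, hC, x₀, h⟩ := smoothKernel_le hf hy
  set κ : ℝ := (k : ℝ) * (y - 1) with hκ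
  have hκ0 : 0 ≤ κ := mul_nonneg (Nat.cast_nonneg _) (by linarith)
  refine ⟨C * (2 : ℝ) ^ κ, by positivity, fun θ hθ hθ1 => ?_⟩
  filter_upwards [eventually_ge_atTop (max x₀ 2)] with x hx
  have hxx₀ : x₀ ≤ x := le_of_max_le_left hx
  have hx2 : (2 : ℝ) ≤ x := by exact_mod_cast le_of_max_le_right hx
  have hx0 : (0 : ℝ) < x := by linarith
  have hx1 : (1 : ℝ) ≤ x := by linarith
  have hlogx : 0 < Real.log x := Real.log_pos (by linarith)
  have hxθ1 : (1 : ℝ) ≤ (x : ℝ) ^ θ := Real.one_le_rpow hx1 hθ.le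
  set S : ℕ := ⌊(x : ℝ) ^ θ⌋₊ + 1 with hSdef
  have hN : 0 ≤ C * (2 : ℝ) ^ κ * Real.exp (-1 / θ) * ((x : ℝ) * Real.log x ^ κ) := by positivity
  by_cases hcase : (x : ℝ) ^ θ < 2
  · -- `x^θ < 2`: `S = 2`, no `2`-smooth tuple has level `> x ≥ 2`
    have hfloor : ⌊(x : ℝ) ^ θ⌋₊ = 1 := by
      rw [Nat.floor_eq_iff (by linarith)]
      exact ⟨by exact_mod_cast hxθ1, by push_cast; linarith⟩
    have hS2 : S = 2 := by rw [hSdef, hfloor]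
    have hzero : ∑ n ∈ range (x + 1), ∑ d ∈ (tuples f n).filter
        (fun d => x < ∏ i, d i ∧ (∏ i, d i) ∈ Nat.smoothNumbers S), ∏ i, thinWeight y (d i) = 0 := by
      refine Finset.sum_eq_zero fun n _ => Finset.sum_eq_zero fun d hd => ?_
      rw [Finset.mem_filter, hS2, smoothNumbers_two, Set.mem_singleton_iff] at hd
      have hx2' : 2 ≤ x := by exact_mod_cast hx2
      omega
    rw [hzero]
    exact hN
  · -- `x^θ ≥ 2`
    push Not at hcase
    have hS2 : 2 ≤ S := by
      rw [hSdef]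
      have : 1 ≤ ⌊(x : ℝ) ^ θ⌋₊ := Nat.le_floor (by exact_mod_cast hxθ1)
      omega
    have hSreal : (S : ℝ) ≤ 2 * (x : ℝ) ^ θ := by
      rw [hSdef]; push_cast
      linarith [Nat.floor_le (show (0 : ℝ) ≤ (x : ℝ) ^ θ by positivity)]
    have hSgt : (x : ℝ) ^ θ < S := by rw [hSdef]; push_cast; exact Nat.lt_floor_add_one _
    have hS0 : (0 : ℝ) < S := by linarith
    have hθlogx : θ * Real.log x = Real.log ((x : ℝ) ^ θ) := (Real.log_rpow hx0 θ).symm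
    have hlog2 : Real.log 2 ≤ θ * Real.log x := by
      rw [hθlogx]; exact Real.log_le_log (by norm_num) hcase
    have hlogS_le : Real.log S ≤ 2 * (θ * Real.log x) := by
      calc Real.log S ≤ Real.log (2 * (x : ℝ) ^ θ) := Real.log_le_log hS0 hSreal
        _ = Real.log 2 + θ * Real.log x := by
            rw [Real.log_mul (by norm_num) (by positivity), hθlogx]
        _ ≤ 2 * (θ * Real.log x) := by linarith
    have hlogS_gt : θ * Real.log x < Real.log S := by
      rw [hθlogx]; exact Real.log_lt_log (by positivity) hSgt
    have hθL : 0 < θ * Real.log x := mul_pos hθ hlogx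
    have hlogS : 0 < Real.log S := lt_trans hθL hlogS_gt
    -- the two comparisons
    have hexp : Real.exp (-(2 * Real.log x) / Real.log S) ≤ Real.exp (-1 / θ) := by
      rw [Real.exp_le_exp, div_le_div_iff₀ hlogS hθ]
      nlinarith
    have hpow : Real.log S ^ κ ≤ (2 : ℝ) ^ κ * Real.log x ^ κ := by
      rw [← Real.mul_rpow (by norm_num) hlogx.le]
      exact Real.rpow_le_rpow hlogS.le (by nlinarith) hκ0
    calc ∑ n ∈ range (x + 1), ∑ d ∈ (tuples f n).filter
            (fun d => x < ∏ i, d i ∧ (∏ i, d i) ∈ Nat.smoothNumbers S), ∏ i, thinWeight y (d i)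
        ≤ C * ((x : ℝ) * Real.exp (-(2 * Real.log x) / Real.log S) * Real.log S ^ κ) := h x hxx₀ S hS2
      _ ≤ C * ((x : ℝ) * Real.exp (-1 / θ) * ((2 : ℝ) ^ κ * Real.log x ^ κ)) := by gcongr
      _ = C * (2 : ℝ) ^ κ * Real.exp (-1 / θ) * ((x : ℝ) * Real.log x ^ κ) := by ring

/-- **stub_smoothKernel_negligible** (registered stub of the skeleton, the lead's): closed form of
`smoothKernel_negligible`. [folklore] -/
theorem stub_smoothKernel_negligible :
    ∀ (k : ℕ) (f : Fin k → ℤ[X]), IsBatemanHornSystem f → ∀ y : ℝ, 1 ≤ y →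
      ∃ C : ℝ, 0 < C ∧ ∀ θ : ℝ, 0 < θ → θ ≤ 1 → ∀ᶠ x : ℕ in atTop,
        (∑ n ∈ range (x + 1), ∑ d ∈ (tuples f n).filter
            (fun d => x < ∏ i, d i ∧ (∏ i, d i) ∈ Nat.smoothNumbers (⌊(x : ℝ) ^ θ⌋₊ + 1)),
              ∏ i, thinWeight y (d i)) ≤
          C * Real.exp (-1 / θ) * ((x : ℝ) * Real.log x ^ ((k : ℝ) * (y - 1))) :=
  fun _k _f hf _y hy => smoothKernel_negligible hf hy

end Assembly

end

end Summit.Parity.BatemanHorn.Cruxes.SystemLSDRealSegment.BetaThinnedRootKernel
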